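import Mathlib.Topology.Covering.AddCircle
import Mathlib.Topology.Instances.ZMultiples
import Mathlib.Topology.Homotopy.Lifting
import Mathlib.AlgebraicTopology.FundamentalGroupoid.SimplyConnected
import HarnessLib

/-!
# Real lifts of circle-valued maps along paths in a simply connected space

Topic `Literature/AlgebraicTopology/FundamentalGroup`. The elementary covering-space remark
behind every "winding number" argument (Hatcher, *Algebraic Topology* (2002), Prop. 1.30
(homotopy lifting for covering spaces) with Prop. 1.5 / Thm. 1.7 (`π₁(S¹) ≅ ℤ` via lifts to
`ℝ`); tom Dieck, *Algebraic Topology* (2008), §2.7 "the winding number", (2.7.3)–(2.7.5)):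

> if `X` is simply connected and `g : X → ℝ/pℤ` is continuous, then along any path `γ` in
> `X` the increment `G(1) - G(0)` of a continuous real lift `G` of `g ∘ γ` (i.e.
> `G(t) mod p = g(γ(t))`) depends only on the end points of `γ`; along a loop it vanishes.

Indeed two paths with the same end points are homotopic rel `{0, 1}` in a simply connected
space (Mathlib `SimplyConnectedSpace.paths_homotopic`), so are their images under `g`, and
lifted paths of homotopic paths through the covering map `ℝ → ℝ/pℤ` (Mathlib
`AddCircle.isCoveringMap_coe`) starting at the same point end at the same point (Mathlib
`IsCoveringMap.liftPath_apply_one_eq_of_homotopicRel`); a continuous real lift is *the* lifted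
path by uniqueness of lifts (`IsCoveringMap.eq_liftPath_iff`). Everything here is **proved**;
the file packages the statement in the form used by degree arguments on manifolds (a
circle-valued "collapse" map and a loop crossing a two-sided hypersurface once: the loop is not
null-homotopic), e.g. `Literature/Topology/FourManifolds/HomotopyTwoSphereNoSaddle.lean`.

* `Literature.AlgebraicTopology.FundamentalGroup.AddCircle.lift_sub_eq_lift_sub` — two paths
  `α`, `β` from `x` to `y`, real lifts `A`, `B` of `g ∘ α`, `g ∘ β`: `A 1 - A 0 = B 1 - B 0`.
* `Literature.AlgebraicTopology.FundamentalGroup.AddCircle.lift_apply_one_eq` — along a loop a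
  real lift returns to its initial value.
* `Literature.AlgebraicTopology.FundamentalGroup.AddCircle.not_simplyConnectedSpace_of_lift` —
  contrapositive: a circle-valued map with a loop along which some real lift does not close up
  shows that the space is not simply connected.

## References

* A. Hatcher, *Algebraic Topology*, CUP (2002), Prop. 1.30, Prop. 1.5, Thm. 1.7.
  [HatcherAT2002]
* T. tom Dieck, *Algebraic Topology*, EMS (2008), §2.7 (2.7.3)–(2.7.5), §3.2. [tomDieck2008]
-/

noncomputable section

open scoped unitInterval
open ContinuousMap

namespace Literature.AlgebraicTopology.FundamentalGroup

namespace AddCircle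

variable {X : Type*} [TopologicalSpace X] {p : ℝ}

/-- A continuous real function `G` on `[0, 1]` with `G t mod p = g (γ t)` is the lifted path of
`g ∘ γ` through the covering `ℝ → ℝ/pℤ` starting at `G 0` (uniqueness of lifts; Hatcher 2002,
Prop. 1.30). [cite: HatcherAT2002, Prop. 1.30] -/
theorem eq_liftPath (g : C(X, _root_.AddCircle p)) {x y : X} (γ : Path x y) {G : I → ℝ}
    (hG : Continuous G) (hlift : ∀ t, ((G t : ℝ) : _root_.AddCircle p) = g (γ t)) :
    G = (AddCircle.isCoveringMap_coe p).liftPath (g.comp γ.toContinuousMap) (G 0)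
      (by simpa using (hlift 0).symm) := by
  rw [IsCoveringMap.eq_liftPath_iff]
  refine ⟨hG, ?_, rfl⟩
  funext t
  simpa using hlift t

/-- **The increment of a real lift depends only on the end points** (simply connected `X`).
Let `g : X → ℝ/pℤ` be continuous, `α`, `β` paths from `x` to `y`, and `A`, `B` continuous real
functions on `[0, 1]` lifting `g ∘ α`, `g ∘ β`. Then `A 1 - A 0 = B 1 - B 0`: the paths are
homotopic rel end points (`SimplyConnectedSpace.paths_homotopic`), hence so are `g ∘ α`,
`g ∘ β`, and lifts of homotopic paths from a common starting point have a common end point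
(Hatcher 2002, Prop. 1.30; the lift `B` is, up to the constant `B 0 - A 0 ∈ pℤ`, the lift of
`g ∘ β` starting at `A 0`). [cite: HatcherAT2002, Prop. 1.30 (with Prop. 1.5)] -/
theorem lift_sub_eq_lift_sub [SimplyConnectedSpace X] (g : C(X, _root_.AddCircle p)) {x y : X}
    (α β : Path x y) {A B : I → ℝ} (hA : Continuous A) (hB : Continuous B)
    (hAg : ∀ t, ((A t : ℝ) : _root_.AddCircle p) = g (α t))
    (hBg : ∀ t, ((B t : ℝ) : _root_.AddCircle p) = g (β t)) :
    A 1 - A 0 = B 1 - B 0 := by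
  set cov := AddCircle.isCoveringMap_coe p
  -- the shifted lift of `g ∘ β` starting at `A 0`
  set B' : I → ℝ := fun t => B t + (A 0 - B 0) with hB'
  have hshift : (((A 0 - B 0 : ℝ)) : _root_.AddCircle p) = 0 := by
    have h0 : ((A 0 : ℝ) : _root_.AddCircle p) = ((B 0 : ℝ) : _root_.AddCircle p) := by
      rw [hAg 0, hBg 0, α.source, β.source]
    rw [AddCircle.coe_sub, h0, sub_self]
  have hB'g : ∀ t, ((B' t : ℝ) : _root_.AddCircle p) = g (β t) := fun t => by
    simp only [hB']
    rw [AddCircle.coe_add, hshift, add_zero, hBg t]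
  have hB'c : Continuous B' := hB.add continuous_const
  -- both are lifted paths starting at `A 0`
  have hA_eq := eq_liftPath g α hA hAg
  have h00 : B' 0 = A 0 := by simp [hB']
  have hB'_eq : B' = IsCoveringMap.liftPath cov (g.comp β.toContinuousMap) (A 0)
      (by simpa [h00] using (hB'g 0).symm) := by
    rw [IsCoveringMap.eq_liftPath_iff]
    refine ⟨hB'c, ?_, h00⟩
    funext t
    simpa using hB'g t
  -- the two image paths are homotopic rel end points
  have hhom : (g.comp α.toContinuousMap).HomotopicRel (g.comp β.toContinuousMap) {0, 1} := by
    obtain ⟨H⟩ := SimplyConnectedSpace.paths_homotopic α β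
    exact ⟨H.map g⟩
  have hend := IsCoveringMap.liftPath_apply_one_eq_of_homotopicRel cov hhom (A 0)
    (by simpa using (hAg 0).symm) (by simpa [h00] using (hB'g 0).symm)
  have hA1 : A 1 = IsCoveringMap.liftPath cov (g.comp α.toContinuousMap) (A 0)
      (by simpa using (hAg 0).symm) 1 := congrFun hA_eq 1
  have hB'1 : B' 1 = IsCoveringMap.liftPath cov (g.comp β.toContinuousMap) (A 0)
      (by simpa [h00] using (hB'g 0).symm) 1 := congrFun hB'_eq 1
  rw [hA1, hend, ← hB'1]
  simp only [hB']
  ring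

/-- **Along a loop in a simply connected space every real lift of a circle-valued map closes
up**: `G 1 = G 0` (Hatcher 2002, Prop. 1.30 with Prop. 1.5: the loop is null-homotopic, so is
its image in `ℝ/pℤ`, whose lift therefore ends where the lift of the constant loop ends). [cite: HatcherAT2002, Prop. 1.30 (with Prop. 1.5)] -/
theorem lift_apply_one_eq [SimplyConnectedSpace X] (g : C(X, _root_.AddCircle p)) {x : X}
    (γ : Path x x) {G : I → ℝ} (hG : Continuous G)
    (hlift : ∀ t, ((G t : ℝ) : _root_.AddCircle p) = g (γ t)) : G 1 = G 0 := by
  have h := lift_sub_eq_lift_sub g γ (Path.refl x) hG continuous_const hlift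
    (B := fun _ => G 0) (fun t => by simpa [γ.source] using hlift 0)
  simpa [sub_eq_zero] using h

/-- **A circle-valued map with a non-closing lift along a loop detects `π₁ ≠ 1`.** If
`g : X → ℝ/pℤ` is continuous and some loop `γ` carries a continuous real lift `G` of `g ∘ γ`
with `G 1 ≠ G 0`, then `X` is not simply connected (tom Dieck 2008, §2.7: the degree of
`g ∘ γ` is `(G 1 - G 0)/p ≠ 0`). [cite: tomDieck2008, §2.7 (2.7.3)–(2.7.5)] -/
theorem not_simplyConnectedSpace_of_lift (g : C(X, _root_.AddCircle p)) {x : X} (γ : Path x x)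
    {G : I → ℝ} (hG : Continuous G) (hlift : ∀ t, ((G t : ℝ) : _root_.AddCircle p) = g (γ t))
    (hne : G 1 ≠ G 0) : ¬ SimplyConnectedSpace X := fun _ =>
  hne (lift_apply_one_eq g γ hG hlift)

/-- **Two-path form of the contrapositive**: paths `α`, `β` with the same end points whose real
lifts have different increments show that `X` is not simply connected. [cite: HatcherAT2002, Prop. 1.30 (with Prop. 1.5)] -/
theorem not_simplyConnectedSpace_of_lift_sub_ne (g : C(X, _root_.AddCircle p)) {x y : X}
    (α β : Path x y) {A B : I → ℝ} (hA : Continuous A) (hB : Continuous B)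
    (hAg : ∀ t, ((A t : ℝ) : _root_.AddCircle p) = g (α t))
    (hBg : ∀ t, ((B t : ℝ) : _root_.AddCircle p) = g (β t)) (hne : A 1 - A 0 ≠ B 1 - B 0) :
    ¬ SimplyConnectedSpace X := fun _ =>
  hne (lift_sub_eq_lift_sub g α β hA hB hAg hBg)

end AddCircle

end Literature.AlgebraicTopology.FundamentalGroup

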